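import Literature.MathematicalPhysics.QuantumFieldTheory.Balaban1983to89.B6Eq238TwoLevelBox

/-!
# `Balaban1983to89.B9Ineq344PaddedPair` — the PADDED COMPARISON PAIR of the dual local comparison ([B9] (3.44)–(3.45) at U = 1,
# `B9Ineq344DualComparisonTorus`): a local operator `A_□` with inverse `G_□` on a sub-carrier `X′ ↪ X`, padded by the identity
# off the image, gives a GLOBAL pair `G^cA^c = 1` on `X` with `G^c` symmetric that acts as `resᵀA_□res` ∕ `resᵀG_□res` on vectors
# supported in the image — the shape required by `CommDatum` ∕ `LocalSecondOrderKIdx`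

T. Bałaban, *Propagators for lattice gauge theories in a background field*, Commun. Math. Phys. **99** (1985) 389–434
[`Balaban1985BackgroundPropagators`, "B9"]; [4] = T. Bałaban, *Propagators and renormalization transformations for lattice
gauge theories. II*, Commun. Math. Phys. **96** (1984) 223–250 [`Balaban1984PropagatorsII`]; [B4] = T. Bałaban, *Regularity and
decay of lattice Green's functions*, Commun. Math. Phys. **89** (1983) 571–597 [`Balaban1983RegularityDecay`].

statement-level skeleton of published theorems with citation tags; proofs where landed; nothing here is a claim about the
Yang–Mills mass gap

THE PRINTED LOCI (verbatim).  [4] (2.37) p. 229: *"G′(□) is an inverse of Δ′_a with some boundary conditions on the boundary of □,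
e.g. with Neumann boundary conditions as in [3]"*; [B4] §2 p. 575 (operators on sub-boxes, extension by zero).  The cube
propagators of lit-balaban-p21's torus programme are padded restrictions `resᵀ·G′(□)·res` (`B6Eq238TwoLevelBox.gPad`).

THE POINT.  This seat's FILES 16–18 reduced row 11 of the N06 knit to `LocalSecondOrderKIdx`: for each source block a pair
`(A^c, G^c)` ON THE WHOLE TORUS with `G^cA^c = 1`, `G^c` symmetric, `A^c = −Δ + V^c` on functions supported near the block.  The
intended comparison operator is LOCAL (a box operator `A_□` with `G_□A_□ = 1 = A_□G_□` on the box carrier `X′`, charted by an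
injective `e : X′ → X`).  THIS FILE supplies the algebra that globalises it:

* `padOp e M := resᵀ·M·res + (1 − resᵀ·res)` (the local operator padded by the identity off the image);
* `padOp_mul` (`padOp M · padOp N = padOp (M·N)`, from `res·resᵀ = 1`), `padOp_one`, ★ `padOp_mul_eq_one` (`G_□A_□ = 1 ⇒
  padOp G_□ · padOp A_□ = 1`), ★ `padOp_isSymm`, ★ `padOp_mulVec_of_supp` (on vectors supported in the image `padOp M` acts as
  `resᵀ·M·res`), `padOp_mulVec_transpose_res` (`padOp M (resᵀu) = resᵀ(Mu)`).

HONEST SCOPE.  Finite-matrix algebra only (any finite carriers); nothing of [B9]∕[4]∕[B4] is asserted; count-neutral; N06 NOT discharged;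
nothing continuum, nothing about the mass gap.  Cell `pub-ymgap` (HUMAN RULING D-0062), Track A node N06 [B9], N06-ASSIGNMENT v1
row 11 (bundle F3), seat `pub-ymgap-dag-n06-h` (g4), 2026-08-27.
-/

noncomputable section

namespace Literature.MathematicalPhysics.QuantumFieldTheory.Balaban1983to89.B9Ineq344PaddedPair

open Matrix
open B6Eq238TwoLevelBox (res res_apply res_mul_transpose_res transpose_res_mulVec_img transpose_res_mulVec_off res_mulVec)

variable {X X' : Type*} [Fintype X] [Fintype X'] [DecidableEq X] [DecidableEq X']

/-- **THE PADDED OPERATOR**: `resᵀ·M·res + (1 − resᵀ·res)` — the local operator on the image of `e`, the identity off it.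
[cite: Balaban1984PropagatorsII, (2.37) p.229 («G′(□) … with Neumann boundary conditions»); Balaban1983RegularityDecay, §2 p.575, dictionary] -/
def padOp (e : X' → X) (M : Matrix X' X' ℝ) : Matrix X X ℝ := (res e)ᵀ * M * res e + (1 - (res e)ᵀ * res e)

/-- `res·(resᵀ·Z) = Z` (restriction after extension). [cite: Balaban1983RegularityDecay, §2 p.575, dictionary] -/
theorem res_mul_transpose_res_mul {Y : Type*} {e : X' → X} (he : Function.Injective e) (Z : Matrix X' Y ℝ) :
    res e * ((res e)ᵀ * Z) = Z := by
  rw [← Matrix.mul_assoc, res_mul_transpose_res he, Matrix.one_mul]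

/-- **PRODUCTS OF PADDED OPERATORS**: `padOp M · padOp N = padOp (M·N)`. [cite: Balaban1983RegularityDecay, §2 p.575, dictionary] -/
theorem padOp_mul {e : X' → X} (he : Function.Injective e) (M N : Matrix X' X' ℝ) :
    padOp e M * padOp e N = padOp e (M * N) := by
  unfold padOp
  set r := res e with hr
  have h1 : r * rᵀ = 1 := res_mul_transpose_res he
  -- the four products
  have p1 : rᵀ * M * r * (rᵀ * N * r) = rᵀ * (M * N) * r := by
    calc rᵀ * M * r * (rᵀ * N * r) = rᵀ * M * (r * rᵀ) * N * r := by simp only [Matrix.mul_assoc]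
      _ = rᵀ * (M * N) * r := by rw [h1, Matrix.mul_one]; simp only [Matrix.mul_assoc]
  have p2 : rᵀ * M * r * (1 - rᵀ * r) = 0 := by
    rw [Matrix.mul_sub, Matrix.mul_one]
    have : rᵀ * M * r * (rᵀ * r) = rᵀ * M * r := by
      calc rᵀ * M * r * (rᵀ * r) = rᵀ * M * (r * rᵀ) * r := by simp only [Matrix.mul_assoc]
        _ = rᵀ * M * r := by rw [h1, Matrix.mul_one]
    rw [this, sub_self]
  have p3 : (1 - rᵀ * r) * (rᵀ * N * r) = 0 := by
    rw [Matrix.sub_mul, Matrix.one_mul]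
    have : rᵀ * r * (rᵀ * N * r) = rᵀ * N * r := by
      calc rᵀ * r * (rᵀ * N * r) = rᵀ * (r * rᵀ) * N * r := by simp only [Matrix.mul_assoc]
        _ = rᵀ * N * r := by rw [h1, Matrix.mul_one]
    rw [this, sub_self]
  have p4 : (1 - rᵀ * r) * (1 - rᵀ * r) = 1 - rᵀ * r := by
    rw [Matrix.sub_mul, Matrix.one_mul, Matrix.mul_sub, Matrix.mul_one]
    have : rᵀ * r * (rᵀ * r) = rᵀ * r := by
      calc rᵀ * r * (rᵀ * r) = rᵀ * (r * rᵀ) * r := by simp only [Matrix.mul_assoc]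
        _ = rᵀ * r := by rw [h1, Matrix.mul_one]
    rw [this, sub_self, sub_zero]
  rw [Matrix.add_mul, Matrix.mul_add, Matrix.mul_add, p1, p2, p3, p4, add_zero, zero_add]

omit [Fintype X] in
/-- `padOp 1 = 1`. [cite: Balaban1983RegularityDecay, §2 p.575, dictionary] -/
theorem padOp_one (e : X' → X) : padOp e (1 : Matrix X' X' ℝ) = 1 := by
  unfold padOp
  rw [Matrix.mul_one, add_sub_cancel]

/-- ★ **A LOCAL INVERSE PAIR PADS TO A GLOBAL ONE**: `G_□·A_□ = 1` on the box carrier ⇒ `padOp G_□ · padOp A_□ = 1` on `X`.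
[cite: Balaban1984PropagatorsII, (2.37) p.229; Balaban1983RegularityDecay, §2 p.575, dictionary] -/
theorem padOp_mul_eq_one {e : X' → X} (he : Function.Injective e) {G A : Matrix X' X' ℝ} (hGA : G * A = 1) :
    padOp e G * padOp e A = 1 := by
  rw [padOp_mul he, hGA, padOp_one]

omit [Fintype X] [DecidableEq X'] in
/-- ★ **PADDING PRESERVES SYMMETRY**. [cite: Balaban1984PropagatorsII, p.225 («a well defined, positive operator»), dictionary] -/
theorem padOp_isSymm (e : X' → X) {M : Matrix X' X' ℝ} (hM : M.IsSymm) : (padOp e M).IsSymm := by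
  unfold padOp Matrix.IsSymm
  rw [Matrix.transpose_add, Matrix.transpose_sub, Matrix.transpose_one, Matrix.transpose_mul, Matrix.transpose_mul,
    Matrix.transpose_transpose, hM.eq, Matrix.transpose_mul, Matrix.transpose_transpose, ← Matrix.mul_assoc]

omit [DecidableEq X'] in
/-- `resᵀ·res` is the indicator of the image: `(resᵀ(res u))(x) = u(x)` on the image and `0` off it.
[cite: Balaban1983RegularityDecay, §2 p.575 (extension by zero), dictionary] -/
theorem transpose_res_res_mulVec {e : X' → X} (he : Function.Injective e) (u : X → ℝ) (x : X) :
    (((res e)ᵀ * res e) *ᵥ u) x = if ∃ a, e a = x then u x else 0 := by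
  rw [← Matrix.mulVec_mulVec]
  split_ifs with h
  · obtain ⟨a, rfl⟩ := h
    rw [transpose_res_mulVec_img he, res_mulVec]
  · push Not at h
    exact transpose_res_mulVec_off e _ h

omit [DecidableEq X'] in
/-- ★ **ON VECTORS SUPPORTED IN THE IMAGE THE PADDED OPERATOR IS THE LOCAL ONE**: `padOp M u = resᵀ(M(res u))` whenever `u`
vanishes off the image of `e`. [cite: Balaban1983RegularityDecay, §2 p.575, dictionary] -/
theorem padOp_mulVec_of_supp {e : X' → X} (he : Function.Injective e) (M : Matrix X' X' ℝ) (u : X → ℝ)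
    (hu : ∀ x, (∀ a, e a ≠ x) → u x = 0) : padOp e M *ᵥ u = (res e)ᵀ *ᵥ (M *ᵥ (res e *ᵥ u)) := by
  unfold padOp
  have hproj : ((res e)ᵀ * res e) *ᵥ u = u := by
    funext x
    rw [transpose_res_res_mulVec he]
    split_ifs with h
    · rfl
    · push Not at h
      exact (hu x h).symm
  rw [Matrix.add_mulVec, Matrix.sub_mulVec, Matrix.one_mulVec, hproj, sub_self, add_zero, ← Matrix.mulVec_mulVec,
    ← Matrix.mulVec_mulVec]

/-- **THE PADDED OPERATOR ON AN EXTENDED VECTOR**: `padOp M (resᵀ v) = resᵀ (M v)`. [cite: Balaban1983RegularityDecay, §2 p.575, dictionary] -/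
theorem padOp_mulVec_transpose_res {e : X' → X} (he : Function.Injective e) (M : Matrix X' X' ℝ) (v : X' → ℝ) :
    padOp e M *ᵥ ((res e)ᵀ *ᵥ v) = (res e)ᵀ *ᵥ (M *ᵥ v) := by
  have h1 : res e *ᵥ ((res e)ᵀ *ᵥ v) = v := by
    rw [Matrix.mulVec_mulVec, res_mul_transpose_res he, Matrix.one_mulVec]
  rw [padOp_mulVec_of_supp he M _ (fun x hx => transpose_res_mulVec_off e v hx), h1]

/-- entries of a padded operator between two image points are the entries of the local operator.
[cite: Balaban1983RegularityDecay, §2 p.575, dictionary] -/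
theorem padOp_apply_img {e : X' → X} (he : Function.Injective e) (M : Matrix X' X' ℝ) (a b : X') :
    padOp e M (e a) (e b) = M a b := by
  -- `resᵀ δ_b = δ_{e b}`
  have hδ : (res e)ᵀ *ᵥ (Pi.single b (1 : ℝ)) = Pi.single (e b) 1 := by
    funext x
    by_cases hx : ∃ a', e a' = x
    · obtain ⟨a', rfl⟩ := hx
      rw [transpose_res_mulVec_img he]
      by_cases hab : a' = b
      · subst hab; simp
      · rw [Pi.single_eq_of_ne hab, Pi.single_eq_of_ne (fun h => hab (he h))]
    · push Not at hx
      rw [transpose_res_mulVec_off e _ hx, Pi.single_eq_of_ne (fun h => hx b h.symm)]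
  have h0 := padOp_mulVec_transpose_res he M (Pi.single b 1)
  rw [hδ] at h0
  have h1 := congrFun h0 (e a)
  rw [transpose_res_mulVec_img he, Matrix.mulVec_single_one, Matrix.mulVec_single_one] at h1
  exact h1

end Literature.MathematicalPhysics.QuantumFieldTheory.Balaban1983to89.B9Ineq344PaddedPair

end
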